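import Summits.RiemannHypothesis.RiemannHypothesis.Theorems.SoloInformedGroundStateEquivalence

/-!
# Ground-state endgame, V-f: partial visibility gives partial zero-free half-planes

Solo programme `solo-RiemannHypothesis-informed`, session 3 (part 6 of the operator-free endgame).

The visibility criterion (part 3) asks for the subexponential condition "for every `κ > 0`".  At a
FIXED rate `κ ≥ 0` the same argument lands on the thermometer of part I
(`riemannZeta_ne_zero_of_weilGroundEnergy_exp_lower`): if on every large window a ground state,
or a unit near-minimiser, lies within `L²`-distance `√δ < 1` of a window test `k` with
`Z₁(k; ·) E(a) ≤ B e^{κa}` (resp. `4 Z₁(k; ·) E(a) + s ≤ B e^{κa}`), then `ζ(s) ≠ 0` for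
`Re s > (1+κ)/2` (`riemannZeta_ne_zero_of_visible_groundStates`,
`riemannZeta_ne_zero_of_visible_near_minimisers`).  `κ = 0⁺` is the Riemann hypothesis (part 3),
`κ = 1` is trivial, and every `κ ∈ (0, 1)` is an open quasi-Riemann hypothesis: partial visibility
is worth exactly a partial half-plane, no more and no less (part I, `width_iff_…`).
-/

noncomputable section

open Complex Filter Set Topology Metric MeasureTheory
open Literature.NumberTheory.LFunctions Literature.NumberTheory.LFunctions.WeilContinuous
open scoped ComplexConjugate

namespace Summit.RiemannHypothesis.RiemannHypothesis.Theorems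

section HalfPlane

variable {κ B a₀ δ : ℝ}

/-- **Zero-free half-plane from visible ground states at a fixed rate.**  `0 ≤ κ`, `δ < 1`; if
every window `a ≥ a₀` carries a ground state `u`, a window test `k` and `A` with `Z₁(k; ·) ≤ A`,
`A e^{a/2}√(2a) ≤ B e^{κa}` and `‖u − k‖₂² ≤ δ`, then `ζ(s) ≠ 0` for `Re s > (1+κ)/2`. -/
theorem riemannZeta_ne_zero_of_visible_groundStates (hκ : 0 ≤ κ) (hδ : δ < 1)
    (H : ∀ a : ℝ, a₀ ≤ a → ∃ (u k : ℝ → ℂ) (A : ℝ), IsWeilGroundState a u ∧ IsWeilTest k ∧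
      tsupport k ⊆ Icc (-a) a ∧
      (∀ T : ℝ, ∑ᶠ ρ ∈ weilZeroIndex T, (riemannZetaZeroOrder ρ : ℝ) * ‖weilMellin k ρ‖ ≤ A) ∧
      A * (Real.exp (a / 2) * Real.sqrt (2 * a)) ≤ B * Real.exp (κ * a) ∧
      ∫ t, ‖u t - k t‖ ^ 2 ≤ δ)
    {s : ℂ} (hs : (1 + κ) / 2 < s.re) : riemannZeta s ≠ 0 := by
  intro hζ
  have hρ := ZetaZeros.riemannZetaNontrivialZeros.mem_of_re_pos hζ (by linarith)
  have h := (abs_le.1 (abs_re_sub_half_le_of_visible_groundStates hκ hδ H hρ)).2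
  linarith

/-- **Strip width from visible near-minimisers at a fixed rate.**  `0 ≤ κ`, `δ < 1`; if every
window `a ≥ a₀` carries a normalised test `g` with `Re Q(g) ≤ ε(a) + s`, `s ≥ 0`, a window test `k`
and `A` with `Z₁(k; ·) ≤ A`, `4 A e^{a/2}√(2a) + s ≤ B e^{κa}` and `‖g − k‖₂² ≤ δ`, then every
non-trivial zero has `|Re ρ − 1/2| ≤ κ/2`. -/
theorem abs_re_sub_half_le_of_visible_near_minimisers (hκ : 0 ≤ κ) (hδ : δ < 1)
    (H : ∀ a : ℝ, a₀ ≤ a → ∃ (g k : ℝ → ℂ) (A s : ℝ), IsWeilTest g ∧ tsupport g ⊆ Icc (-a) a ∧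
      ∫ t, ‖g t‖ ^ 2 = 1 ∧ 0 ≤ s ∧ (weilQuadratic g).re ≤ weilGroundEnergy a + s ∧
      IsWeilTest k ∧ tsupport k ⊆ Icc (-a) a ∧
      (∀ T : ℝ, ∑ᶠ ρ ∈ weilZeroIndex T, (riemannZetaZeroOrder ρ : ℝ) * ‖weilMellin k ρ‖ ≤ A) ∧
      4 * (A * (Real.exp (a / 2) * Real.sqrt (2 * a))) + s ≤ B * Real.exp (κ * a) ∧
      ∫ t, ‖g t - k t‖ ^ 2 ≤ δ)
    {ρ : ℂ} (hρ : ρ ∈ ZetaZeros.riemannZetaNontrivialZeros) : |ρ.re - 1 / 2| ≤ κ / 2 := by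
  have hposδ : 0 < 1 - δ := sub_pos.2 hδ
  refine abs_re_sub_half_le_of_weilGroundEnergy_exp_lower (C := B / (1 - δ)) (a₀ := max a₀ 0) hκ
    (fun a ha ↦ ?_) hρ
  obtain ⟨g, k, A, s, hg, hgs, hg1, hs, hgap, hk, hks, hA, hAB, hΔ⟩ :=
    H a ((le_max_left _ _).trans ha)
  have ha0 : 0 ≤ a := (le_max_right _ _).trans ha
  have key := weilGroundEnergy_ge_of_visible_near_minimiser hδ ha0 hg hgs hg1 hs hgap hk hks hA hΔ
  have hcmp : (4 * (A * (Real.exp (a / 2) * Real.sqrt (2 * a))) + s) / (1 - δ) ≤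
      B / (1 - δ) * Real.exp (κ * a) := by
    rw [div_mul_eq_mul_div, div_le_div_iff_of_pos_right hposδ]
    exact hAB
  linarith

/-- **Zero-free half-plane from visible near-minimisers at a fixed rate.**  Under the hypotheses
of `abs_re_sub_half_le_of_visible_near_minimisers`, `ζ(s) ≠ 0` for `Re s > (1+κ)/2`. -/
theorem riemannZeta_ne_zero_of_visible_near_minimisers (hκ : 0 ≤ κ) (hδ : δ < 1)
    (H : ∀ a : ℝ, a₀ ≤ a → ∃ (g k : ℝ → ℂ) (A s : ℝ), IsWeilTest g ∧ tsupport g ⊆ Icc (-a) a ∧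
      ∫ t, ‖g t‖ ^ 2 = 1 ∧ 0 ≤ s ∧ (weilQuadratic g).re ≤ weilGroundEnergy a + s ∧
      IsWeilTest k ∧ tsupport k ⊆ Icc (-a) a ∧
      (∀ T : ℝ, ∑ᶠ ρ ∈ weilZeroIndex T, (riemannZetaZeroOrder ρ : ℝ) * ‖weilMellin k ρ‖ ≤ A) ∧
      4 * (A * (Real.exp (a / 2) * Real.sqrt (2 * a))) + s ≤ B * Real.exp (κ * a) ∧
      ∫ t, ‖g t - k t‖ ^ 2 ≤ δ)
    {s : ℂ} (hs : (1 + κ) / 2 < s.re) : riemannZeta s ≠ 0 := by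
  intro hζ
  have hρ := ZetaZeros.riemannZetaNontrivialZeros.mem_of_re_pos hζ (by linarith)
  have h := (abs_le.1 (abs_re_sub_half_le_of_visible_near_minimisers hκ hδ H hρ)).2
  linarith

end HalfPlane

end Summit.RiemannHypothesis.RiemannHypothesis.Theorems
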